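import Literature.AlgebraicGeometry.Motives.ExtendedMumfordTateGroup
import Literature.AlgebraicGeometry.Motives.MumfordTateGroupDiagonal
import HarnessLib

/-!
# Deligne's group `G = MT♯ ⊂ GL(V) × 𝔾_m` of a direct summand, of a direct sum and of a sum of copies, on
# `K`-points: `G(H₁ ⊕ H₂)(K) ⊆ G(H₁)(K) ×_{Kˣ} G(H₂)(K)` and `G(H^{⊕ι})(K) = Δ G(H)(K)`

Layer `Literature/AlgebraicGeometry/Motives` (lane `lit-hodgefound`, Track 2 foundations library; seat
`lit-hodgefound-p34`, row g12-#4). PROVED theorems only; no definition, no named fact (net debt 0). Sequel of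
`Motives/MumfordTateGroupDirectSum` (row g9-#1: `MT(H₁ ⊕ H₂)(K) ⊆ MT(H₁)(K) × MT(H₂)(K)`,
`MT(H ⊕ H)(K) ⊆ Δ MT(H)(K)`), `Motives/MumfordTateGroupDiagonal` (row g10-#1: `Δ MT(H)(K) ⊆ MT(H^{⊕ι})(K)`) and
`Motives/ExtendedMumfordTateGroup` (row g11-#1: Deligne's `G(K) = H.extendedMumfordTateGroupBaseChange K`, the
`K`-points of the subgroup of `GL(V) × 𝔾_m` acting on every rational Hodge class `t ∈ T^{a,b} V` of type `(p,p)`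
by `ρ(g) t = νᵖ t`), which it combines: the same statements for the extended ("big") Mumford–Tate group, whose
second coordinate `ν ∈ Kˣ` — the multiplier keeping track of the Tate twists — is COMMON to all summands.

## Sources, verbatim

* B. Moonen, *An introduction to Mumford–Tate groups* (lecture notes, 2004) [Moonen2004MT] (materialised text
  `paper:url-8e52397fca11`, p0009 L10–L22): "**(4.6) Lemma.** If `V₁` and `V₂` are `ℚ`-HS then
  `MT(V₁ ⊕ V₂) ⊂ MT(V₁) × MT(V₂)` as subgroups of `GL(V₁ ⊕ V₂)`, and the projection maps
  `prᵢ : MT(V₁ ⊕ V₂) → MT(Vᵢ)` are surjective. *Proof.* Immediate from the definition of the Mumford-Tate group. □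
  **(4.7)** In practice it is often convenient to consider not only all tensor spaces (plus subquotients) obtained
  from a Hodge structure `V`, but also to include all Tate twists of such. What one does for this is the
  following. Define the "big Mumford-Tate group of `V`" to be `MT♯(V) := MT(V ⊕ ℚ(1))`. The Mumford-Tate group of
  `ℚ(1)` is just the multiplicative group `𝔾_m`, so by the lemma `MT♯(V)` may be considered as a subgroup of
  `MT(V) × 𝔾_m`, with surjective projections onto the two factors. […] The action of `MT♯(V)` on `T^ν(r)` is the
  tensor product of the action on `T^ν` via the projection `MT♯(V) → MT(V)`, and the action on `ℚ(1)^{⊗r}` via the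
  projection `MT♯(V) → 𝔾_m = GL(ℚ(1))`."; p0009 L53–L54: "**(4.10) Exercise.** Let `V` be a `ℚ`-HS, purely of
  some weight `m`. If `n ⩾ 1`, show that `MT(Vⁿ) = MT(V)`, where we view `MT(V)` as a subgroup of `GL(Vⁿ)`
  through its diagonal action on `Vⁿ`."  (By the lemma applied to `(V₁ ⊕ ℚ(1)) ⊕ V₂` and to `V₁ ⊕ (V₂ ⊕ ℚ(1))`,
  `MT♯(V₁ ⊕ V₂) ⊂ MT♯(V₁) ×_{𝔾_m} MT♯(V₂)`: the two big Mumford–Tate groups share the factor `𝔾_m = MT(ℚ(1))`.)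
* B. Moonen, *Notes on Mumford–Tate groups* (Centre Émile Borel, 1999) [Moonen1999MTNotes] (materialised text
  `paper:url-c4d52097ebb3`, p0005 L18–L34): "**(1.13) The Hodge group of a product.** Let `V₁` and `V₂` be
  `ℚ`-HS. Write `V := V₁ ⊕ V₂`. It readily follows from the definitions that `Hg(V) ⊆ Hg(V₁) × Hg(V₂)` and that
  the two projections `Hg(V) → Hg(Vᵢ)` are surjective. […] if `V₁ = V₂` then `Hg(V)` is the diagonal subgroup of
  `Hg(V₁) × Hg(V₂)`; see (1.8). […] For the Mumford-Tate group similar statements hold, but note that `MT(V)` is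
  almost never equal to `MT(V₁) × MT(V₂)`. This is because the central factor `𝔾_m` ("keeping track of the
  weight") is counted twice in `MT(V₁) × MT(V₂)`, unless one of the `Vᵢ` has weight `0`. **(1.14) The extended
  Mumford-Tate group.** […] `M̃T(V)` can be described as the smallest algebraic `ℚ`-subgroup
  `M ⊂ GL(V) × 𝔾_{m,ℚ}` such that `h × Nm : 𝕊 → GL(V)_ℝ × 𝔾_{m,ℝ}` factors through `M_ℝ`. […] We leave it to
  the reader to formulate a version of the Key Property for `M̃T(V)`. (Consider tensor spaces of the form
  `T^{m,n,p} := V^{⊗m} ⊗ (V^*)^{⊗n} ⊗ ℚ(p)`.)"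
* P. Deligne, *Hodge cycles on abelian varieties* (notes by J. Milne), LNM 900 (1982) [Deligne1982HodgeCycles],
  I §3.1 (the spaces `T = V^{⊗m₁} ⊗ V^{∨⊗m₂} ⊗ ℚ(1)^{⊗m₃}` and the group `G ⊂ GL(V) × 𝔾_m` fixing the rational
  tensors of type `(0,0)` in them).

## What is proved (for every field `K ⊇ ℚ`; `G(H)(K) = H.extendedMumfordTateGroupBaseChange K`)

* §0 (linear algebra over a field) the two transfer principles of rows g9-#1 / g10-#1 with a scalar:
  `tensorSpaceActOver_restrictRetract_eq_smul` (if `ρ(γ)` multiplies `T(ι, π) t` by `c` then `ρ(π γ ι)`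
  multiplies `t` by `c`) and `tensorSpaceActOver_eq_smul_of_forall_blocks` (if `ρ(γ₁)` multiplies every
  component `T(pr ε, in δ) s` by `c` then the block-scalar `ρ(γ)` multiplies `s` by `c`).
* §1 **`restrictBaseChange_mk_mem_extendedMumfordTateGroupBaseChange`: `(π_K g ι_K, ν) ∈ G(H₁)(K)` for
  `(g, ν) ∈ G(H)(K)`** and a direct summand `ι : H₁ → H`, `π : H → H₁`, `π ι = id` (Moonen's `prᵢ` for `MT♯`, the
  multiplier `ν` being kept: a Hodge class of type `(p,p)` of `H₁` is transported to one of `H`).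
* §2 **`G(H₁ ⊕ H₂)(K) ⊆ G(H₁)(K) ×_{Kˣ} G(H₂)(K)`**: every `(g, ν) ∈ G(H₁ ⊕ H₂)(K)` is `(g₁ ⊕ g₂, ν)` with
  `(g₁, ν) ∈ G(H₁)(K)` and `(g₂, ν) ∈ G(H₂)(K)` (`exists_blockDiag_eq_of_mem_extendedMumfordTateGroupBaseChange_prod`;
  the SAME `ν` — "the central factor `𝔾_m` […] is counted twice in `MT(V₁) × MT(V₂)`").
* §3 `mk_mem_extendedMumfordTateGroupBaseChange_of_blocks`: a block-scalar automorphism whose block `(γ₁, ν)`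
  lies in `G(H₁)(K)` lies, with the same `ν`, in `G(H)(K)` (`H = ` a sum of copies of `H₁` through morphisms
  `in_j`, `pr_j`, `Σ in_j pr_j = id`).
* §4 **`mem_extendedMumfordTateGroupBaseChange_prod_self_iff`: `(g', ν) ∈ G(H ⊕ H)(K) ↔ g' = g ⊕ g` with
  `(g, ν) ∈ G(H)(K)`** (the diagonal, (4.10) / (1.13) for `MT♯`), and §5 the same for `H^{⊕ι}`, `ι` finite
  nonempty (`mem_extendedMumfordTateGroupBaseChange_pi_const_iff`).
* §6 (rider) **`G(⊕_j H_j)(K) ⊆ Π_j G(H_j)(K)` over one multiplier** for a finite family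
  (`exists_piBlockDiag_eq_of_mem_extendedMumfordTateGroupBaseChange_pi`: `(g, ν) = (⊕_j g_j, ν)` with every
  `(g_j, ν) ∈ G(H_j)(K)`).

NOT here: the surjectivity of the projections `G(H₁ ⊕ H₂) → G(Hᵢ)` (a statement about the algebraic groups,
not about points), and anything on `MT♯(V) = MT(V ⊕ ℚ(1))` as a Mumford–Tate group of a direct sum of
different weights (the tree's Hodge structures are pure of one weight; Deligne's tensor description of `G` is
the tree's definition).

## References

* [Moonen2004MT] B. Moonen, An introduction to Mumford–Tate groups (2004), §4 Lemma 4.6, (4.7), Exercise 4.10.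
* [Moonen1999MTNotes] B. Moonen, Notes on Mumford–Tate groups, Centre Émile Borel (1999), (1.8), (1.13), (1.14).
* [Deligne1982HodgeCycles] P. Deligne, Hodge cycles on abelian varieties, in LNM 900 (1982), I §3.1.
-/

noncomputable section

open scoped TensorProduct

namespace Literature.AlgebraicGeometry.Motives

/-! ### §0 Linear algebra: transfer of `ρ(γ) s = c • s` to a retract, and from the blocks of a sum of copies -/

section LinearAlgebra

universe uK u₁ u₂

variable {K : Type uK} [Field K] {W₁ : Type u₁} [AddCommGroup W₁] [Module K W₁]
  {W : Type u₂} [AddCommGroup W] [Module K W]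

/-- **Transfer of an eigen-relation to a retract**: for a retract `ι : W₁ → W`, `π : W → W₁`, `π ι = id`, and an
automorphism `γ` of `W` commuting with `ι π`, if `ρ(γ)` multiplies `T(ι, π) t` by `c` then `ρ(π γ ι)` multiplies
`t` by `c` (apply the retraction `T(π, ι)`; the case `c = 1` is row g9-#1's
`tensorSpaceActOver_restrictRetract_eq_self`). This is Moonen's "immediate from the definition" for the big
Mumford–Tate group, whose elements act on Hodge tensors by the scalars `νᵖ`.
[cite: Moonen2004MT, §4 Lemma 4.6 and (4.7)] [cite: Deligne1982HodgeCycles, I §3.1] -/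
theorem tensorSpaceActOver_restrictRetract_eq_smul (ι : W₁ →ₗ[K] W) (π : W →ₗ[K] W₁)
    (hπι : ∀ x, π (ι x) = x) (γ : W ≃ₗ[K] W) (hγ : ∀ x, ι (π (γ x)) = γ (ι (π x))) {a b : ℕ} (c : K)
    {t : hodgeTensorSpaceOver K W₁ a b}
    (ht : tensorSpaceActOver γ (tensorSpaceMapOver ι π a b t) = c • tensorSpaceMapOver ι π a b t) :
    tensorSpaceActOver (restrictRetract ι π hπι γ hγ) t = c • t := by
  have hπι' : π ∘ₗ ι = LinearMap.id := LinearMap.ext hπι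
  rw [← tensorSpaceMapOver_retract hπι' (tensorSpaceActOver (restrictRetract ι π hπι γ hγ) t),
    tensorSpaceMapOver_tensorSpaceActOver_restrictRetract, ht, map_smul, tensorSpaceMapOver_retract hπι']

/-- **Transfer of an eigen-relation from the blocks to a block-scalar automorphism.** Let
`id_W = Σ_j in_j ∘ pr_j` (`in_j : W₁ → W`, `pr_j : W → W₁`), and let automorphisms `γ₁` of `W₁`, `γ` of `W`
satisfy `in_j γ₁ = γ in_j`, `pr_j γ = γ₁ pr_j` for all `j`. If `ρ(γ₁)` multiplies every component
`T(pr ∘ ε, in ∘ δ) s ∈ T^{a,b}_K W₁` of `s ∈ T^{a,b}_K W` by `c`, then `ρ(γ)` multiplies `s` by `c`: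
`ρ(γ) s = Σ ρ(γ) T(in ε, pr δ) T(pr ε, in δ) s = Σ T(in ε, pr δ) ρ(γ₁) T(pr ε, in δ) s = c • s` (the case
`c = 1` is row g10-#1's `tensorSpaceActOver_eq_self_of_forall_blocks`).
[cite: Moonen2004MT, §4 Exercise 4.10 and (4.7)] [cite: Moonen1999MTNotes, (1.8) and (1.14)] -/
theorem tensorSpaceActOver_eq_smul_of_forall_blocks {J : Type*} [Fintype J]
    (inj : J → (W₁ →ₗ[K] W)) (pr : J → (W →ₗ[K] W₁))
    (hsum : ∑ j, inj j ∘ₗ pr j = LinearMap.id) {γ₁ : W₁ ≃ₗ[K] W₁} {γ : W ≃ₗ[K] W}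
    (hinj : ∀ j, inj j ∘ₗ (γ₁ : W₁ →ₗ[K] W₁) = (γ : W →ₗ[K] W) ∘ₗ inj j)
    (hpr : ∀ j, pr j ∘ₗ (γ : W →ₗ[K] W) = (γ₁ : W₁ →ₗ[K] W₁) ∘ₗ pr j) {a b : ℕ} (c : K)
    {s : hodgeTensorSpaceOver K W a b}
    (hs : ∀ (ε : Fin a → J) (δ : Fin b → J),
      tensorSpaceActOver γ₁ (tensorSpaceMapOverFamily (fun i => pr (ε i)) (fun j => inj (δ j)) s) =
        c • tensorSpaceMapOverFamily (fun i => pr (ε i)) (fun j => inj (δ j)) s) :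
    tensorSpaceActOver γ s = c • s := by
  -- the inverse form of `hpr`: `γ₁⁻¹ pr_j = pr_j γ⁻¹`
  have hpr' : ∀ j, (γ₁.symm : W₁ →ₗ[K] W₁) ∘ₗ pr j = pr j ∘ₗ (γ.symm : W →ₗ[K] W) := by
    intro j
    refine LinearMap.ext fun x => ?_
    simp only [LinearMap.coe_comp, Function.comp_apply, LinearEquiv.coe_coe]
    rw [LinearEquiv.symm_apply_eq]
    have h := LinearMap.congr_fun (hpr j) (γ.symm x)
    simp only [LinearMap.coe_comp, Function.comp_apply, LinearEquiv.coe_coe,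
      LinearEquiv.apply_symm_apply] at h
    exact h
  have hexp := sum_tensorSpaceMapOverFamily_eq_id (fun j => inj j ∘ₗ pr j) hsum a b
  have hcomp : ∀ (ε : Fin a → J) (δ : Fin b → J),
      tensorSpaceMapOverFamily (fun i => inj (ε i) ∘ₗ pr (ε i)) (fun j => inj (δ j) ∘ₗ pr (δ j)) =
        tensorSpaceMapOverFamily (fun i => inj (ε i)) (fun j => pr (δ j)) ∘ₗ
          tensorSpaceMapOverFamily (a := a) (b := b) (fun i => pr (ε i)) (fun j => inj (δ j)) :=
    fun ε δ => (tensorSpaceMapOverFamily_comp _ _ _ _).symm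
  have hnat : ∀ (ε : Fin a → J) (δ : Fin b → J) (t : hodgeTensorSpaceOver K W₁ a b),
      tensorSpaceMapOverFamily (fun i => inj (ε i)) (fun j => pr (δ j)) (tensorSpaceActOver γ₁ t) =
        tensorSpaceActOver γ (tensorSpaceMapOverFamily (fun i => inj (ε i)) (fun j => pr (δ j)) t) :=
    fun ε δ t => tensorSpaceMapOverFamily_tensorSpaceActOver _ _ (fun i => hinj (ε i))
      (fun j => hpr' (δ j)) t
  have hs' : s = ∑ ε : Fin a → J, ∑ δ : Fin b → J,
      tensorSpaceMapOverFamily (fun i => inj (ε i)) (fun j => pr (δ j))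
        (tensorSpaceMapOverFamily (fun i => pr (ε i)) (fun j => inj (δ j)) s) := by
    have h := LinearMap.congr_fun hexp s
    simp only [LinearMap.sum_apply, LinearMap.id_apply, hcomp, LinearMap.comp_apply] at h
    exact h.symm
  have key : tensorSpaceActOver γ s = ∑ ε : Fin a → J, ∑ δ : Fin b → J,
      c • tensorSpaceMapOverFamily (fun i => inj (ε i)) (fun j => pr (δ j))
        (tensorSpaceMapOverFamily (fun i => pr (ε i)) (fun j => inj (δ j)) s) := by
    conv_lhs => rw [hs']
    simp only [map_sum, ← hnat, hs, map_smul]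
  rw [key]
  conv_rhs => rw [hs']
  simp only [Finset.smul_sum]

end LinearAlgebra

namespace HodgeStructure

/-! ### §1 The restriction of `G(H)(K)` to a direct summand -/

section Retract

universe u v

variable {V₁ : Type u} [AddCommGroup V₁] [Module ℚ V₁] [Module.Finite ℚ V₁]
  {V : Type u} [AddCommGroup V] [Module ℚ V] [Module.Finite ℚ V] [HodgeTensorFacts.{u, u}] {n : ℤ}
  {H₁ : HodgeStructure V₁ n} {H : HodgeStructure V n} (K : Type v) [Field K] [Algebra ℚ K]

/-- **The big Mumford–Tate group of a direct summand, on `K`-points: `(π_K g ι_K, ν) ∈ G(H₁)(K)` for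
`(g, ν) ∈ G(H)(K)`** (`ι : H₁ → H`, `π : H → H₁` morphisms of Hodge structures with `π ι = id`; the restriction
`π_K g ι_K = restrictBaseChange K ι π _ _` of row g9-#1, formed with `g ∈ MT(H)(K)`,
`fst_mem_mumfordTateGroupBaseChange_of_mem`). Proof: a rational Hodge class `t ∈ T^{a,b} V₁` of type `(p,p)` is
carried by `T = ι^{⊗a} ⊗ (πᵀ)^{⊗b}` to one of `H` (`tensorSpaceMapOver_mem_hodgeClasses`), on which `ρ(g)` is `νᵖ`;
`T_K ρ(π_K g ι_K) = ρ(g) T_K` and `T_K` has a retraction. Moonen's `prᵢ` for `MT♯ ⊂ MT × 𝔾_m`, the factor `𝔾_m`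
("the action on `ℚ(1)^{⊗r}` via the projection `MT♯(V) → 𝔾_m`") being carried along unchanged.
[cite: Moonen2004MT, §4 Lemma 4.6 and (4.7)] [cite: Moonen1999MTNotes, (1.13)–(1.14)] -/
theorem restrictBaseChange_mk_mem_extendedMumfordTateGroupBaseChange (ι : Hom H₁ H) (π : Hom H H₁)
    (hπι : ∀ v, π.toLinearMap (ι.toLinearMap v) = v) {γ : ((K ⊗[ℚ] V) ≃ₗ[K] (K ⊗[ℚ] V)) × Kˣ}
    (hγ : γ ∈ H.extendedMumfordTateGroupBaseChange K) :
    (restrictBaseChange K ι π hπι (fst_mem_mumfordTateGroupBaseChange_of_mem K H hγ), γ.2) ∈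
      H₁.extendedMumfordTateGroupBaseChange K := by
  rw [mem_extendedMumfordTateGroupBaseChange_iff]
  intro a b p hp t ht
  dsimp only
  refine tensorSpaceActOver_restrictRetract_eq_smul _ _ _ γ.1 _ _ ?_
  rw [← tensorSpaceToBaseChange_tensorSpaceMapOver]
  exact (mem_extendedMumfordTateGroupBaseChange_iff K H γ).1 hγ a b p hp _
    (tensorSpaceMapOver_mem_hodgeClasses ι π ht)

/-- The restricted pair has the same multiplier and its first coordinate lies in `MT(H₁)(K)` (row g9-#1's
`restrictBaseChange_mem_mumfordTateGroupBaseChange`, recorded for the pair). [cite: Moonen2004MT, §4 Lemma 4.6 and (4.7)] -/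
theorem restrictBaseChange_mem_mumfordTateGroupBaseChange_of_mem_extendedMumfordTateGroupBaseChange
    (ι : Hom H₁ H) (π : Hom H H₁) (hπι : ∀ v, π.toLinearMap (ι.toLinearMap v) = v)
    {γ : ((K ⊗[ℚ] V) ≃ₗ[K] (K ⊗[ℚ] V)) × Kˣ} (hγ : γ ∈ H.extendedMumfordTateGroupBaseChange K) :
    restrictBaseChange K ι π hπι (fst_mem_mumfordTateGroupBaseChange_of_mem K H hγ) ∈
      H₁.mumfordTateGroupBaseChange K :=
  restrictBaseChange_mem_mumfordTateGroupBaseChange K ι π hπι _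

end Retract

/-! ### §2 Direct sums: `G(H₁ ⊕ H₂)(K) ⊆ G(H₁)(K) ×_{Kˣ} G(H₂)(K)` -/

section Prod

universe u v

variable {V₁ : Type u} [AddCommGroup V₁] [Module ℚ V₁] [Module.Finite ℚ V₁]
  {V₂ : Type u} [AddCommGroup V₂] [Module ℚ V₂] [Module.Finite ℚ V₂] [HodgeTensorFacts.{u, u}]
  {n : ℤ} {H₁ : HodgeStructure V₁ n} {H₂ : HodgeStructure V₂ n} {K : Type v} [Field K] [Algebra ℚ K]

/-- **The first block of `(g, ν) ∈ G(H₁ ⊕ H₂)(K)`, with the same multiplier, lies in `G(H₁)(K)`: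
`(fst_K g inl_K, ν) ∈ G(H₁)(K)`.** [cite: Moonen2004MT, §4 Lemma 4.6 and (4.7)] [cite: Moonen1999MTNotes, (1.13)–(1.14)] -/
theorem fst_block_mk_mem_extendedMumfordTateGroupBaseChange_of_mem_prod
    {γ : ((K ⊗[ℚ] (V₁ × V₂)) ≃ₗ[K] (K ⊗[ℚ] (V₁ × V₂))) × Kˣ}
    (hγ : γ ∈ (H₁.prod H₂).extendedMumfordTateGroupBaseChange K) :
    (restrictBaseChange K (Hom.prodInl H₁ H₂) (Hom.prodFst H₁ H₂) (prodFst_prodInl_apply H₁ H₂)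
        (fst_mem_mumfordTateGroupBaseChange_of_mem K _ hγ), γ.2) ∈
      H₁.extendedMumfordTateGroupBaseChange K :=
  restrictBaseChange_mk_mem_extendedMumfordTateGroupBaseChange K _ _ _ hγ

/-- **The second block of `(g, ν) ∈ G(H₁ ⊕ H₂)(K)`, with the same multiplier, lies in `G(H₂)(K)`:
`(snd_K g inr_K, ν) ∈ G(H₂)(K)`.** [cite: Moonen2004MT, §4 Lemma 4.6 and (4.7)] [cite: Moonen1999MTNotes, (1.13)–(1.14)] -/
theorem snd_block_mk_mem_extendedMumfordTateGroupBaseChange_of_mem_prod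
    {γ : ((K ⊗[ℚ] (V₁ × V₂)) ≃ₗ[K] (K ⊗[ℚ] (V₁ × V₂))) × Kˣ}
    (hγ : γ ∈ (H₁.prod H₂).extendedMumfordTateGroupBaseChange K) :
    (restrictBaseChange K (Hom.prodInr H₁ H₂) (Hom.prodSnd H₁ H₂) (prodSnd_prodInr_apply H₁ H₂)
        (fst_mem_mumfordTateGroupBaseChange_of_mem K _ hγ), γ.2) ∈
      H₂.extendedMumfordTateGroupBaseChange K :=
  restrictBaseChange_mk_mem_extendedMumfordTateGroupBaseChange K _ _ _ hγ

/-- **`G(H₁ ⊕ H₂)(K) ⊆ G(H₁)(K) ×_{Kˣ} G(H₂)(K)`, on `K`-points, for every field `K ⊇ ℚ`**: every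
`(g, ν) ∈ G(H₁ ⊕ H₂)(K)` is `(g₁ ⊕ g₂, ν)` — block diagonal through row g9-#1's `blockDiag` — with
`(g₁, ν) ∈ G(H₁)(K)` AND `(g₂, ν) ∈ G(H₂)(K)` for the one multiplier `ν` (Moonen's Lemma 4.6 for
`MT♯(Vᵢ) ⊂ MT(Vᵢ) × 𝔾_m`, the factor `𝔾_m = MT(ℚ(1))` being shared: "the central factor `𝔾_m` […] is counted
twice in `MT(V₁) × MT(V₂)`"). The surjectivity of the two projections is a statement about the algebraic
groups and is not claimed. [cite: Moonen2004MT, §4 Lemma 4.6 and (4.7)] [cite: Moonen1999MTNotes, (1.13)–(1.14)] -/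
theorem exists_blockDiag_eq_of_mem_extendedMumfordTateGroupBaseChange_prod
    {γ : ((K ⊗[ℚ] (V₁ × V₂)) ≃ₗ[K] (K ⊗[ℚ] (V₁ × V₂))) × Kˣ}
    (hγ : γ ∈ (H₁.prod H₂).extendedMumfordTateGroupBaseChange K) :
    ∃ (g₁ : (K ⊗[ℚ] V₁) ≃ₗ[K] (K ⊗[ℚ] V₁)) (g₂ : (K ⊗[ℚ] V₂) ≃ₗ[K] (K ⊗[ℚ] V₂)),
      (g₁, γ.2) ∈ H₁.extendedMumfordTateGroupBaseChange K ∧ (g₂, γ.2) ∈ H₂.extendedMumfordTateGroupBaseChange K ∧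
        blockDiag K V₁ V₂ (g₁, g₂) = γ.1 := by
  have hMT := fst_mem_mumfordTateGroupBaseChange_of_mem K _ hγ
  refine ⟨restrictBaseChange K (Hom.prodInl H₁ H₂) (Hom.prodFst H₁ H₂) (prodFst_prodInl_apply H₁ H₂) hMT,
    restrictBaseChange K (Hom.prodInr H₁ H₂) (Hom.prodSnd H₁ H₂) (prodSnd_prodInr_apply H₁ H₂) hMT,
    fst_block_mk_mem_extendedMumfordTateGroupBaseChange_of_mem_prod hγ,
    snd_block_mk_mem_extendedMumfordTateGroupBaseChange_of_mem_prod hγ, ?_⟩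
  refine LinearEquiv.toLinearMap_injective ?_
  rw [coe_blockDiag, eq_blockDiag_of_mem_mumfordTateGroupBaseChange_prod hMT]

/-- The two blocks of an element of `G(H₁ ⊕ H₂)(K)` with `ν = 1` lie in the Hodge groups `Hg(Hᵢ)(K)` (the kernel
of `G → 𝔾_m` is `Hg`, row g11-#1; Moonen 1999 (1.13) `Hg(V₁ ⊕ V₂) ⊆ Hg(V₁) × Hg(V₂)` recovered through `G`).
[cite: Moonen1999MTNotes, (1.13)] [cite: Moonen2004MT, §4 Lemma 4.6] -/
theorem exists_blockDiag_eq_of_mk_one_mem_extendedMumfordTateGroupBaseChange_prod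
    {g : (K ⊗[ℚ] (V₁ × V₂)) ≃ₗ[K] (K ⊗[ℚ] (V₁ × V₂))}
    (hg : (g, (1 : Kˣ)) ∈ (H₁.prod H₂).extendedMumfordTateGroupBaseChange K) :
    ∃ (g₁ : (K ⊗[ℚ] V₁) ≃ₗ[K] (K ⊗[ℚ] V₁)) (g₂ : (K ⊗[ℚ] V₂) ≃ₗ[K] (K ⊗[ℚ] V₂)),
      g₁ ∈ H₁.hodgeGroupBaseChange K ∧ g₂ ∈ H₂.hodgeGroupBaseChange K ∧ blockDiag K V₁ V₂ (g₁, g₂) = g := by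
  obtain ⟨g₁, g₂, h₁, h₂, h⟩ := exists_blockDiag_eq_of_mem_extendedMumfordTateGroupBaseChange_prod hg
  exact ⟨g₁, g₂, (mk_one_mem_extendedMumfordTateGroupBaseChange_iff K H₁ g₁).1 h₁,
    (mk_one_mem_extendedMumfordTateGroupBaseChange_iff K H₂ g₂).1 h₂, h⟩

end Prod

/-! ### §3 Block-scalar automorphisms with block in `G(H₁)(K)` lie in `G(H)(K)`, with the same multiplier -/

section TransportFamily

universe u v

variable {V₁ : Type u} [AddCommGroup V₁] [Module ℚ V₁] [Module.Finite ℚ V₁]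
  {V : Type u} [AddCommGroup V] [Module ℚ V] [Module.Finite ℚ V] [HodgeTensorFacts.{u, u}] {n : ℤ}
  {H₁ : HodgeStructure V₁ n} {H : HodgeStructure V n} (K : Type v) [Field K] [Algebra ℚ K]
  {J : Type} [Fintype J]

omit [Module.Finite ℚ V₁] [Module.Finite ℚ V] [HodgeTensorFacts.{u, u}] in
/-- Base change of a finite sum of composites: `Σ_j (f_j)_K ∘ (g_j)_K = (Σ_j f_j ∘ g_j)_K`. Private plumbing
(row g10-#1 has the same lemma privately). [folklore] -/
private theorem sum_baseChange_comp_baseChange' (f : J → (V₁ →ₗ[ℚ] V)) (g : J → (V →ₗ[ℚ] V₁)) :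
    ∑ j, (f j).baseChange K ∘ₗ (g j).baseChange K = (∑ j, f j ∘ₗ g j).baseChange K := by
  have h : ∀ j, (f j).baseChange K ∘ₗ (g j).baseChange K = (f j ∘ₗ g j).baseChange K := fun j =>
    (LinearMap.baseChange_comp (g j) (f j)).symm
  simp only [h]
  have hs := map_sum (LinearMap.baseChangeHom ℚ K V V) (fun j => f j ∘ₗ g j) Finset.univ
  simp only [LinearMap.baseChangeHom_apply] at hs
  exact hs.symm

/-- **Transfer to a sum of copies, on `K`-points, for `G`.** Let `in_j : H₁ → H`, `pr_j : H → H₁` (`j ∈ J`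
finite) be morphisms of Hodge structures with `Σ_j in_j pr_j = id_V`; let `(γ₁, ν) ∈ G(H₁)(K)` and let
`γ ∈ GL(K ⊗ V)` satisfy `(in_j)_K γ₁ = γ (in_j)_K` and `(pr_j)_K γ = γ₁ (pr_j)_K` for all `j`. Then
`(γ, ν) ∈ G(H)(K)`: a rational Hodge class `s ∈ T^{a,b} V` of type `(p,p)` has components `T(pr ε, in δ) s` that
are such classes of `H₁`, multiplied by `νᵖ` under `ρ(γ₁)`, and `ρ(γ)` is recovered from `ρ(γ₁)` on the
components (`tensorSpaceActOver_eq_smul_of_forall_blocks`). The `MT♯`-form of Moonen's "`MT(Vⁿ) = MT(V)` […]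
through its diagonal action". [cite: Moonen2004MT, §4 Exercise 4.10 and (4.7)] [cite: Moonen1999MTNotes, (1.8) and (1.14)] -/
theorem mk_mem_extendedMumfordTateGroupBaseChange_of_blocks (inj : J → Hom H₁ H) (pr : J → Hom H H₁)
    (hsum : ∑ j, (inj j).toLinearMap ∘ₗ (pr j).toLinearMap = LinearMap.id)
    {γ₁ : (K ⊗[ℚ] V₁) ≃ₗ[K] (K ⊗[ℚ] V₁)} {ν : Kˣ} (hγ₁ : (γ₁, ν) ∈ H₁.extendedMumfordTateGroupBaseChange K)
    {γ : (K ⊗[ℚ] V) ≃ₗ[K] (K ⊗[ℚ] V)}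
    (hinj : ∀ j, (inj j).toLinearMap.baseChange K ∘ₗ (γ₁ : K ⊗[ℚ] V₁ →ₗ[K] K ⊗[ℚ] V₁) =
      (γ : K ⊗[ℚ] V →ₗ[K] K ⊗[ℚ] V) ∘ₗ (inj j).toLinearMap.baseChange K)
    (hpr : ∀ j, (pr j).toLinearMap.baseChange K ∘ₗ (γ : K ⊗[ℚ] V →ₗ[K] K ⊗[ℚ] V) =
      (γ₁ : K ⊗[ℚ] V₁ →ₗ[K] K ⊗[ℚ] V₁) ∘ₗ (pr j).toLinearMap.baseChange K) :
    (γ, ν) ∈ H.extendedMumfordTateGroupBaseChange K := by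
  rw [mem_extendedMumfordTateGroupBaseChange_iff]
  intro a b p hp s hs
  refine tensorSpaceActOver_eq_smul_of_forall_blocks (fun j => (inj j).toLinearMap.baseChange K)
    (fun j => (pr j).toLinearMap.baseChange K) ?_ hinj hpr _ fun ε δ => ?_
  · rw [sum_baseChange_comp_baseChange', hsum, LinearMap.baseChange_id]
  · rw [← tensorSpaceToBaseChange_tensorSpaceMapOverFamily]
    exact (mem_extendedMumfordTateGroupBaseChange_iff K H₁ (γ₁, ν)).1 hγ₁ a b p hp _
      (tensorSpaceMapOverFamily_mem_hodgeClasses (fun i => pr (ε i)) (fun j => inj (δ j)) hs)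

end TransportFamily

/-! ### §4 The diagonal: `G(H ⊕ H)(K) = {(γ ⊕ γ, ν) : (γ, ν) ∈ G(H)(K)}` -/

section Diagonal

universe u v

variable {V : Type u} [AddCommGroup V] [Module ℚ V] [Module.Finite ℚ V] [HodgeTensorFacts.{u, u}]
  {n : ℤ} {H : HodgeStructure V n} (K : Type v) [Field K] [Algebra ℚ K]

omit [Module.Finite ℚ V] [HodgeTensorFacts.{u, u}] in
/-- `fst_K (inl_K x) = x`. Private plumbing. [folklore] -/
private theorem fst_baseChange_inl_baseChange' (x : K ⊗[ℚ] V) :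
    (LinearMap.fst ℚ V V).baseChange K ((LinearMap.inl ℚ V V).baseChange K x) = x := by
  rw [← LinearMap.comp_apply, ← LinearMap.baseChange_comp, LinearMap.fst_comp_inl, LinearMap.baseChange_id,
    LinearMap.id_apply]

omit [Module.Finite ℚ V] [HodgeTensorFacts.{u, u}] in
/-- `snd_K (inl_K x) = 0`. Private plumbing. [folklore] -/
private theorem snd_baseChange_inl_baseChange' (x : K ⊗[ℚ] V) :
    (LinearMap.snd ℚ V V).baseChange K ((LinearMap.inl ℚ V V).baseChange K x) = 0 := by
  rw [← LinearMap.comp_apply, ← LinearMap.baseChange_comp, LinearMap.snd_comp_inl, LinearMap.baseChange_zero,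
    LinearMap.zero_apply]

omit [Module.Finite ℚ V] [HodgeTensorFacts.{u, u}] in
/-- `fst_K (inr_K x) = 0`. Private plumbing. [folklore] -/
private theorem fst_baseChange_inr_baseChange' (x : K ⊗[ℚ] V) :
    (LinearMap.fst ℚ V V).baseChange K ((LinearMap.inr ℚ V V).baseChange K x) = 0 := by
  rw [← LinearMap.comp_apply, ← LinearMap.baseChange_comp, LinearMap.fst_comp_inr, LinearMap.baseChange_zero,
    LinearMap.zero_apply]

omit [Module.Finite ℚ V] [HodgeTensorFacts.{u, u}] in
/-- `snd_K (inr_K x) = x`. Private plumbing. [folklore] -/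
private theorem snd_baseChange_inr_baseChange' (x : K ⊗[ℚ] V) :
    (LinearMap.snd ℚ V V).baseChange K ((LinearMap.inr ℚ V V).baseChange K x) = x := by
  rw [← LinearMap.comp_apply, ← LinearMap.baseChange_comp, LinearMap.snd_comp_inr, LinearMap.baseChange_id,
    LinearMap.id_apply]

/-- **`(γ ⊕ γ, ν) ∈ G(H ⊕ H)(K)` for `(γ, ν) ∈ G(H)(K)`** — the diagonal of Moonen's (4.10) / (1.13) for the big
Mumford–Tate group, on `K`-points, for every field `K ⊇ ℚ`. [cite: Moonen2004MT, §4 Exercise 4.10 and (4.7)]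
[cite: Moonen1999MTNotes, (1.13)–(1.14)] -/
theorem diagEmbedding_mk_mem_extendedMumfordTateGroupBaseChange {γ : (K ⊗[ℚ] V) ≃ₗ[K] (K ⊗[ℚ] V)} {ν : Kˣ}
    (hγ : (γ, ν) ∈ H.extendedMumfordTateGroupBaseChange K) :
    (diagEmbedding K V γ, ν) ∈ (H.prod H).extendedMumfordTateGroupBaseChange K := by
  refine mk_mem_extendedMumfordTateGroupBaseChange_of_blocks K (Hom.prodSelfIn H) (Hom.prodSelfPr H)
    sum_prodSelfIn_comp_prodSelfPr hγ (fun c => ?_) (fun c => ?_)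
  · rw [diagEmbedding_apply, coe_blockDiag]
    refine LinearMap.ext fun x => ?_
    cases c <;> simp [fst_baseChange_inl_baseChange', snd_baseChange_inl_baseChange',
      fst_baseChange_inr_baseChange', snd_baseChange_inr_baseChange']
  · rw [diagEmbedding_apply, coe_blockDiag]
    refine LinearMap.ext fun x => ?_
    cases c <;> simp [fst_baseChange_inl_baseChange', snd_baseChange_inl_baseChange',
      fst_baseChange_inr_baseChange', snd_baseChange_inr_baseChange']

variable {K} in
/-- **Every `(g', ν) ∈ G(H ⊕ H)(K)` is `(γ ⊕ γ, ν)` with `(γ, ν) ∈ G(H)(K)`** (`g' ∈ MT(H ⊕ H)(K)` is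
`γ ⊕ γ` with `γ = fst_K g' inl_K` by rows g9-#1 / g10-#1, and `(γ, ν) ∈ G(H)(K)` by §1).
[cite: Moonen2004MT, §4 Lemma 4.6, (4.7) and Exercise 4.10] [cite: Moonen1999MTNotes, (1.13)–(1.14)] -/
theorem exists_diagEmbedding_eq_of_mem_extendedMumfordTateGroupBaseChange_prod_self
    {γ' : ((K ⊗[ℚ] (V × V)) ≃ₗ[K] (K ⊗[ℚ] (V × V))) × Kˣ}
    (hγ' : γ' ∈ (H.prod H).extendedMumfordTateGroupBaseChange K) :
    ∃ γ : (K ⊗[ℚ] V) ≃ₗ[K] (K ⊗[ℚ] V),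
      (γ, γ'.2) ∈ H.extendedMumfordTateGroupBaseChange K ∧ diagEmbedding K V γ = γ'.1 := by
  have hMT := fst_mem_mumfordTateGroupBaseChange_of_mem K _ hγ'
  refine ⟨restrictBaseChange K (Hom.prodInl H H) (Hom.prodFst H H) (prodFst_prodInl_apply H H) hMT,
    restrictBaseChange_mk_mem_extendedMumfordTateGroupBaseChange K _ _ _ hγ', ?_⟩
  refine LinearEquiv.toLinearMap_injective ?_
  rw [diagEmbedding_apply, coe_blockDiag, eq_blockDiag_of_mem_mumfordTateGroupBaseChange_prod hMT,
    restrictBaseChange_fst_eq_snd_of_mem_prod_self hMT]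

variable {K} in
/-- **`(g', ν) ∈ G(H ⊕ H)(K)` iff `g' = γ ⊕ γ` for some `(γ, ν) ∈ G(H)(K)`** — Moonen's (4.10) / (1.13) "the
diagonal subgroup" for the big Mumford–Tate group `MT♯ = G`, on `K`-points, for every field `K ⊇ ℚ`.
[cite: Moonen2004MT, §4 Exercise 4.10 and (4.7)] [cite: Moonen1999MTNotes, (1.13)–(1.14)] -/
theorem mem_extendedMumfordTateGroupBaseChange_prod_self_iff
    {γ' : ((K ⊗[ℚ] (V × V)) ≃ₗ[K] (K ⊗[ℚ] (V × V))) × Kˣ} :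
    γ' ∈ (H.prod H).extendedMumfordTateGroupBaseChange K ↔
      ∃ γ : (K ⊗[ℚ] V) ≃ₗ[K] (K ⊗[ℚ] V),
        (γ, γ'.2) ∈ H.extendedMumfordTateGroupBaseChange K ∧ diagEmbedding K V γ = γ'.1 := by
  refine ⟨exists_diagEmbedding_eq_of_mem_extendedMumfordTateGroupBaseChange_prod_self, ?_⟩
  rintro ⟨γ, hγ, hγ'⟩
  have h := diagEmbedding_mk_mem_extendedMumfordTateGroupBaseChange K hγ
  rwa [hγ', Prod.mk.eta] at h

variable {K} in
/-- The pair form: `(diagEmbedding γ, ν) ∈ G(H ⊕ H)(K) ↔ (γ, ν) ∈ G(H)(K)` (`diagEmbedding` is injective).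
[cite: Moonen2004MT, §4 Exercise 4.10 and (4.7)] [cite: Moonen1999MTNotes, (1.13)–(1.14)] -/
theorem diagEmbedding_mk_mem_extendedMumfordTateGroupBaseChange_iff {γ : (K ⊗[ℚ] V) ≃ₗ[K] (K ⊗[ℚ] V)}
    {ν : Kˣ} :
    (diagEmbedding K V γ, ν) ∈ (H.prod H).extendedMumfordTateGroupBaseChange K ↔
      (γ, ν) ∈ H.extendedMumfordTateGroupBaseChange K := by
  refine ⟨fun h => ?_, diagEmbedding_mk_mem_extendedMumfordTateGroupBaseChange K⟩
  obtain ⟨γ₀, hγ₀, he⟩ := exists_diagEmbedding_eq_of_mem_extendedMumfordTateGroupBaseChange_prod_self h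
  have hinj : γ₀ = γ := by
    have he' : blockDiag K V V (γ₀, γ₀) = blockDiag K V V (γ, γ) := by
      rw [← diagEmbedding_apply, ← diagEmbedding_apply, he]
    exact (Prod.mk.inj (blockDiag_injective he')).1
  rwa [hinj] at hγ₀

end Diagonal

/-! ### §5 Sums of copies: `G(H^{⊕ι})(K) = Δ G(H)(K)` -/

section PiConst

universe u v

variable {ι : Type} [Fintype ι] [DecidableEq ι] {V : Type u} [AddCommGroup V] [Module ℚ V]
  [Module.Finite ℚ V] [HodgeTensorFacts.{u, u}] {n : ℤ} {H : HodgeStructure V n}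
  (K : Type v) [Field K] [Algebra ℚ K]

/-- **`(Δ γ, ν) ∈ G(H^{⊕ι})(K)` for `(γ, ν) ∈ G(H)(K)`** (`Δ = piDiagEmbedding` of row g10-#1; the blocks
`in_j = Hom.piSingle`, `pr_j = Hom.piProj` sum to the identity). [cite: Moonen2004MT, §4 Exercise 4.10 and (4.7)]
[cite: Moonen1999MTNotes, (1.8) and (1.14)] -/
theorem piDiagEmbedding_mk_mem_extendedMumfordTateGroupBaseChange {γ : (K ⊗[ℚ] V) ≃ₗ[K] (K ⊗[ℚ] V)}
    {ν : Kˣ} (hγ : (γ, ν) ∈ H.extendedMumfordTateGroupBaseChange K) :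
    (piDiagEmbedding K V ι γ, ν) ∈ (pi fun _ : ι => H).extendedMumfordTateGroupBaseChange K := by
  refine mk_mem_extendedMumfordTateGroupBaseChange_of_blocks K (Hom.piSingle fun _ : ι => H)
    (Hom.piProj fun _ : ι => H) sum_piSingle_comp_piProj hγ (fun j => ?_) (fun j => ?_)
  · rw [Hom.piSingle_toLinearMap, piDiagEmbedding_apply, piBlockDiag_comp_single_baseChange]
  · rw [Hom.piProj_toLinearMap, piDiagEmbedding_apply, proj_baseChange_comp_piBlockDiag]

variable {K} in
/-- **Every `(g', ν) ∈ G(H^{⊕ι})(K)` (`ι` nonempty) is `(Δ γ, ν)` with `(γ, ν) ∈ G(H)(K)`**, `γ` the `j₀`-th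
diagonal block `(pr_{j₀})_K g' (in_{j₀})_K` (rows g9-#1 / g10-#1 for `g' ∈ MT(H^{⊕ι})(K)`, §1 for the multiplier).
[cite: Moonen2004MT, §4 Lemma 4.6, (4.7) and Exercise 4.10] [cite: Moonen1999MTNotes, (1.8), (1.13)–(1.14)] -/
theorem exists_piDiagEmbedding_eq_of_mem_extendedMumfordTateGroupBaseChange_pi_const [Nonempty ι]
    {γ' : ((K ⊗[ℚ] (ι → V)) ≃ₗ[K] (K ⊗[ℚ] (ι → V))) × Kˣ}
    (hγ' : γ' ∈ (pi fun _ : ι => H).extendedMumfordTateGroupBaseChange K) :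
    ∃ γ : (K ⊗[ℚ] V) ≃ₗ[K] (K ⊗[ℚ] V),
      (γ, γ'.2) ∈ H.extendedMumfordTateGroupBaseChange K ∧ piDiagEmbedding K V ι γ = γ'.1 := by
  obtain ⟨j₀⟩ := ‹Nonempty ι›
  have hMT := fst_mem_mumfordTateGroupBaseChange_of_mem K _ hγ'
  refine ⟨restrictBaseChange K (Hom.piSingle (fun _ : ι => H) j₀) (Hom.piProj (fun _ : ι => H) j₀)
      (piProj_piSingle_apply (fun _ : ι => H) j₀) hMT,
    restrictBaseChange_mk_mem_extendedMumfordTateGroupBaseChange K _ _ _ hγ', ?_⟩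
  refine LinearEquiv.toLinearMap_injective ?_
  rw [coe_piDiagEmbedding, eq_sum_diag_of_mem_mumfordTateGroupBaseChange_pi_const hMT j₀]

variable {K} in
/-- **`(g', ν) ∈ G(H^{⊕ι})(K)` iff `g' = Δ γ` for some `(γ, ν) ∈ G(H)(K)`** (`ι` finite nonempty, "`n ⩾ 1`"):
Moonen's (4.10) / (1.8) "`MT(V^{⊕n})` is `MT(V)` acting diagonally" for the big Mumford–Tate group, on `K`-points,
for every field `K ⊇ ℚ`. [cite: Moonen2004MT, §4 Exercise 4.10 and (4.7)] [cite: Moonen1999MTNotes, (1.8) and (1.14)] -/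
theorem mem_extendedMumfordTateGroupBaseChange_pi_const_iff [Nonempty ι]
    {γ' : ((K ⊗[ℚ] (ι → V)) ≃ₗ[K] (K ⊗[ℚ] (ι → V))) × Kˣ} :
    γ' ∈ (pi fun _ : ι => H).extendedMumfordTateGroupBaseChange K ↔
      ∃ γ : (K ⊗[ℚ] V) ≃ₗ[K] (K ⊗[ℚ] V),
        (γ, γ'.2) ∈ H.extendedMumfordTateGroupBaseChange K ∧ piDiagEmbedding K V ι γ = γ'.1 := by
  refine ⟨exists_piDiagEmbedding_eq_of_mem_extendedMumfordTateGroupBaseChange_pi_const, ?_⟩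
  rintro ⟨γ, hγ, hγ'⟩
  have h := piDiagEmbedding_mk_mem_extendedMumfordTateGroupBaseChange (ι := ι) K hγ
  rwa [hγ', Prod.mk.eta] at h

variable {K} in
/-- The pair form: `(Δ γ, ν) ∈ G(H^{⊕ι})(K) ↔ (γ, ν) ∈ G(H)(K)` for nonempty `ι` (`Δ` is injective).
[cite: Moonen2004MT, §4 Exercise 4.10 and (4.7)] [cite: Moonen1999MTNotes, (1.8) and (1.14)] -/
theorem piDiagEmbedding_mk_mem_extendedMumfordTateGroupBaseChange_iff [Nonempty ι]
    {γ : (K ⊗[ℚ] V) ≃ₗ[K] (K ⊗[ℚ] V)} {ν : Kˣ} :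
    (piDiagEmbedding K V ι γ, ν) ∈ (pi fun _ : ι => H).extendedMumfordTateGroupBaseChange K ↔
      (γ, ν) ∈ H.extendedMumfordTateGroupBaseChange K := by
  refine ⟨fun h => ?_, piDiagEmbedding_mk_mem_extendedMumfordTateGroupBaseChange K⟩
  obtain ⟨γ₀, hγ₀, he⟩ := exists_piDiagEmbedding_eq_of_mem_extendedMumfordTateGroupBaseChange_pi_const h
  have hinj : γ₀ = γ := piDiagEmbedding_injective he
  rwa [hinj] at hγ₀

end PiConst

/-! ### §6 Finite direct sums: `G(⊕_j H_j)(K) ⊆ Π_j G(H_j)(K)` over ONE multiplier -/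

section Pi

universe u v

variable {ι : Type} [Fintype ι] [DecidableEq ι] {W : ι → Type u} [∀ j, AddCommGroup (W j)]
  [∀ j, Module ℚ (W j)] [∀ j, Module.Finite ℚ (W j)] [HodgeTensorFacts.{u, u}] {n : ℤ}
  {H : ∀ j, HodgeStructure (W j) n} {K : Type v} [Field K] [Algebra ℚ K]

/-- **The `j`-th diagonal block of `(g, ν) ∈ G(⊕_i H_i)(K)`, with the same multiplier, lies in `G(H_j)(K)`:
`((pr_j)_K g (in_j)_K, ν) ∈ G(H_j)(K)`** (§1 for the direct summand `H_j`; Moonen's Lemma 4.6 for finitely many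
summands and the big Mumford–Tate group, on `K`-points). [cite: Moonen2004MT, §4 Lemma 4.6 and (4.7)]
[cite: Moonen1999MTNotes, (1.13)–(1.14)] -/
theorem restrictBaseChange_piSingle_mk_mem_extendedMumfordTateGroupBaseChange
    {γ : ((K ⊗[ℚ] (∀ j, W j)) ≃ₗ[K] (K ⊗[ℚ] (∀ j, W j))) × Kˣ}
    (hγ : γ ∈ (pi H).extendedMumfordTateGroupBaseChange K) (j : ι) :
    (restrictBaseChange K (Hom.piSingle H j) (Hom.piProj H j) (piProj_piSingle_apply H j)
        (fst_mem_mumfordTateGroupBaseChange_of_mem K _ hγ), γ.2) ∈ (H j).extendedMumfordTateGroupBaseChange K :=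
  restrictBaseChange_mk_mem_extendedMumfordTateGroupBaseChange K _ _ _ hγ

/-- **`G(⊕_j H_j)(K) ⊆ Π_j G(H_j)(K)` over one multiplier, on `K`-points, for every field `K ⊇ ℚ`**: every
`(g, ν) ∈ G(⊕_j H_j)(K)` is block diagonal, `g = ⊕_j g_j` (row g10-#1's `piBlockDiag`), with `(g_j, ν) ∈ G(H_j)(K)`
for every `j` and the one multiplier `ν` (Moonen's Lemma 4.6 for finitely many summands, for `MT♯ ⊂ MT × 𝔾_m`).
The surjectivity of the projections is not claimed. [cite: Moonen2004MT, §4 Lemma 4.6 and (4.7)]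
[cite: Moonen1999MTNotes, (1.13)–(1.14)] -/
theorem exists_piBlockDiag_eq_of_mem_extendedMumfordTateGroupBaseChange_pi
    {γ : ((K ⊗[ℚ] (∀ j, W j)) ≃ₗ[K] (K ⊗[ℚ] (∀ j, W j))) × Kˣ}
    (hγ : γ ∈ (pi H).extendedMumfordTateGroupBaseChange K) :
    ∃ g : ∀ j, (K ⊗[ℚ] W j) ≃ₗ[K] (K ⊗[ℚ] W j),
      (∀ j, (g j, γ.2) ∈ (H j).extendedMumfordTateGroupBaseChange K) ∧ piBlockDiag K W g = γ.1 := by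
  have hMT := fst_mem_mumfordTateGroupBaseChange_of_mem K _ hγ
  refine ⟨fun j => restrictBaseChange K (Hom.piSingle H j) (Hom.piProj H j) (piProj_piSingle_apply H j) hMT,
    fun j => restrictBaseChange_piSingle_mk_mem_extendedMumfordTateGroupBaseChange hγ j, ?_⟩
  refine LinearEquiv.toLinearMap_injective ?_
  rw [coe_piBlockDiag, eq_sum_blocks_of_mem_mumfordTateGroupBaseChange_pi hMT]

/-- With `ν = 1`: the blocks of `(g, 1) ∈ G(⊕_j H_j)(K)` lie in the Hodge groups `Hg(H_j)(K)` (Moonen 1999 (1.13)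
for finitely many summands, through `G`). [cite: Moonen1999MTNotes, (1.13)] [cite: Moonen2004MT, §4 Lemma 4.6] -/
theorem exists_piBlockDiag_eq_of_mk_one_mem_extendedMumfordTateGroupBaseChange_pi
    {g : (K ⊗[ℚ] (∀ j, W j)) ≃ₗ[K] (K ⊗[ℚ] (∀ j, W j))}
    (hg : (g, (1 : Kˣ)) ∈ (pi H).extendedMumfordTateGroupBaseChange K) :
    ∃ g' : ∀ j, (K ⊗[ℚ] W j) ≃ₗ[K] (K ⊗[ℚ] W j),
      (∀ j, g' j ∈ (H j).hodgeGroupBaseChange K) ∧ piBlockDiag K W g' = g := by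
  obtain ⟨g', h, he⟩ := exists_piBlockDiag_eq_of_mem_extendedMumfordTateGroupBaseChange_pi hg
  exact ⟨g', fun j => (mk_one_mem_extendedMumfordTateGroupBaseChange_iff K (H j) (g' j)).1 (h j), he⟩

end Pi

end HodgeStructure

end Literature.AlgebraicGeometry.Motives
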